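import Summits.KontsevichZagierPeriods.KontsevichZagierPeriods.Theorems.TerasomaMultiplicationMultiplicationAccessibleCornerGraphRepsGen
import Literature.NumberTheory.Transcendental.KZHomotopyMoves
import Literature.NumberTheory.Transcendental.KZProductIdeal
import Literature.NumberTheory.Transcendental.KZLogCalculusProofs

/-!
# `MultiplicationAccessible` (stmt-KontsevichZagierPeriods-12305), line `shifted-family-prime-sieve`:
geometry of the exceptional-face Newton–Leibniz move of the corner Stokes, general `p = n + 2`

Registered stub `cornerYGeoGen`.  Coordinates `w = (θ₁, …, θ_{n+1}, y, v)` on `ℝ^(n+3)`; the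
`y`-fibre of the open chart domain `Wo` over a point `(θ, v)` of the base
`B = {θ_i > 0, Σ θ_i < 1, 0 < v < 1}` is `(0, b)`, `b = min_k 1/Θ_k` (`Θ₀ = 1 − Σ θ_i`,
`Θ_{i+1} = θ_i`).  For an abstract primitive `c` (semialgebraic on the closed band `Wc`, continuous
on the closed fibres, `0` at `y = b`, the face density at `y = 0`) with bounded semialgebraic
`y`-derivative `d` on `Wo`, ONE rule-3 move with `y` put last (swap `e = (y v)`,
`KZ.exists_band_newtonLeibniz`), opening the fibres and swapping back (rule (2)) give
`[Wo, d] + [R] ∈ KZ.relations` for every representative `R` of the face (template: `cornerStokesY`,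
the case `p = 3`).  References: Kontsevich–Zagier 2001 §1.2 rules (2), (3).
-/

noncomputable section

open MeasureTheory Set Real
open scoped BigOperators
open Literature.NumberTheory.Transcendental
open Literature.NumberTheory.Transcendental.KZ
open Literature.ModelTheory.ExponentialFields (IsSemialgebraic)

namespace Summit.KontsevichZagierPeriods.TerasomaMultiplication.MultiplicationAccessible

namespace CornerYGeo

variable {n : ℕ}

/-- The minimum of two `ℚ`-semialgebraic functions is `ℚ`-semialgebraic
(`min u v = (u + v − |u − v|)/2`). [folklore] -/
theorem isSemialgebraicFunOn_min {m : ℕ} {A : Set (Fin m → ℝ)} (hA : IsSemialgebraic ℚ A)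
    {f g : (Fin m → ℝ) → ℝ} (hf : IsSemialgebraicFunOn ℚ A f) (hg : IsSemialgebraicFunOn ℚ A g) :
    IsSemialgebraicFunOn ℚ A (fun q => min (f q) (g q)) := by
  have h2 : IsSemialgebraicFunOn ℚ A (fun _ : Fin m → ℝ => (2:ℝ)) := by
    simpa using isSemialgebraicFunOn_ratCast hA 2
  refine (((hf.fun_add hg).fun_sub (hf.fun_sub hg).abs).div h2 fun _ _ => two_ne_zero).congr
    fun q _ => ?_
  show (f q + g q - |f q - g q|) / 2 = min (f q) (g q)
  rcases le_total (f q) (g q) with h | h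
  · rw [min_eq_left h, abs_of_nonpos (by linarith)]; ring
  · rw [min_eq_right h, abs_of_nonneg (by linarith)]; ring

/-- A finite non-empty minimum of `ℚ`-semialgebraic functions is `ℚ`-semialgebraic. [folklore] -/
theorem isSemialgebraicFunOn_inf' {m : ℕ} {ι : Type*} {A : Set (Fin m → ℝ)}
    (hA : IsSemialgebraic ℚ A) {F : ι → (Fin m → ℝ) → ℝ} {s : Finset ι} (hs : s.Nonempty)
    (hF : ∀ i ∈ s, IsSemialgebraicFunOn ℚ A (F i)) :
    IsSemialgebraicFunOn ℚ A (fun q => s.inf' hs (fun i => F i q)) := by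
  induction hs using Finset.Nonempty.cons_induction with
  | singleton a => simpa only [Finset.inf'_singleton] using hF a (Finset.mem_singleton_self a)
  | cons a s h hs ih =>
    simpa only [Finset.inf'_cons hs] using isSemialgebraicFunOn_min hA
      (hF a (Finset.mem_cons_self a s)) (ih fun i hi => hF i (Finset.mem_cons_of_mem hi))

/-- Facts about the upper fibre bound `b = min_k 1/Θ_k` over a point with positive weights:
`0 < b`, `bΘ_k = 1` for some `k`, `t ≤ b ↔ ∀ k, tΘ_k ≤ 1`, `t < b ↔ ∀ k, tΘ_k < 1`, `b ≤ n + 2`.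
[folklore] -/
theorem b_props {Θb : (Fin (n + 2) → ℝ) → Fin (n + 2) → ℝ} {b : (Fin (n + 2) → ℝ) → ℝ}
    (hΘb0 : ∀ q, Θb q 0 = 1 - ∑ i : Fin (n + 1), q (Fin.castSucc i))
    (hΘbs : ∀ q (i : Fin (n + 1)), Θb q i.succ = q (Fin.castSucc i))
    (hb : ∀ q, b q = Finset.univ.inf' Finset.univ_nonempty (fun k => (Θb q k)⁻¹))
    {q : Fin (n + 2) → ℝ} (hpos : ∀ i : Fin (n + 1), 0 < q (Fin.castSucc i))
    (hsum : ∑ i : Fin (n + 1), q (Fin.castSucc i) < 1) :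
    0 < b q ∧
    (b q * (1 - ∑ i : Fin (n + 1), q (Fin.castSucc i)) = 1 ∨
      ∃ i : Fin (n + 1), b q * q (Fin.castSucc i) = 1) ∧
    (∀ t, t ≤ b q ↔ (t * (1 - ∑ i : Fin (n + 1), q (Fin.castSucc i)) ≤ 1 ∧
      ∀ i : Fin (n + 1), t * q (Fin.castSucc i) ≤ 1)) ∧
    (∀ t, t < b q ↔ (t * (1 - ∑ i : Fin (n + 1), q (Fin.castSucc i)) < 1 ∧
      ∀ i : Fin (n + 1), t * q (Fin.castSucc i) < 1)) ∧
    b q ≤ (n:ℝ) + 2 := by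
  have hΘpos : ∀ k, 0 < Θb q k := by
    refine Fin.cases ?_ (fun i => ?_)
    · rw [hΘb0]; linarith
    · rw [hΘbs]; exact hpos i
  have hle : ∀ t, t ≤ b q ↔ ∀ k, t * Θb q k ≤ 1 := fun t => by
    rw [hb, Finset.le_inf'_iff]
    simp only [Finset.mem_univ, forall_const]
    exact forall_congr' fun k => by rw [← le_div_iff₀ (hΘpos k), one_div]
  have hlt : ∀ t, t < b q ↔ ∀ k, t * Θb q k < 1 := fun t => by
    rw [hb, Finset.lt_inf'_iff]
    simp only [Finset.mem_univ, forall_const]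
    exact forall_congr' fun k => by rw [← lt_div_iff₀ (hΘpos k), one_div]
  have hsumΘ : ∑ k, Θb q k = 1 := by
    rw [Fin.sum_univ_succ, hΘb0]; simp only [hΘbs]; ring
  refine ⟨?_, ?_, fun t => ?_, fun t => ?_, ?_⟩
  · rw [hlt]; intro k; rw [zero_mul]; exact zero_lt_one
  · obtain ⟨k, -, hk⟩ := Finset.exists_mem_eq_inf' Finset.univ_nonempty (fun k => (Θb q k)⁻¹)
    have hk' : b q * Θb q k = 1 := by rw [hb, hk]; exact inv_mul_cancel₀ (hΘpos k).ne'
    revert hk'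
    refine Fin.cases (fun h => Or.inl ?_) (fun i h => Or.inr ⟨i, ?_⟩) k
    · rwa [hΘb0] at h
    · rwa [hΘbs] at h
  · rw [hle, Fin.forall_fin_succ, hΘb0]; simp only [hΘbs]
  · rw [hlt, Fin.forall_fin_succ, hΘb0]; simp only [hΘbs]
  · calc b q = ∑ k, b q * Θb q k := by rw [← Finset.mul_sum, hsumΘ, mul_one]
      _ ≤ ∑ _k : Fin (n + 2), (1:ℝ) := Finset.sum_le_sum fun k _ => (hle _).1 le_rfl k
      _ = (n:ℝ) + 2 := by simp

/-- The upper fibre bound `b` is `ℚ`-semialgebraic on any `ℚ`-semialgebraic base. [folklore] -/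
theorem isSemialgebraicFunOn_b {Θb : (Fin (n + 2) → ℝ) → Fin (n + 2) → ℝ}
    {b : (Fin (n + 2) → ℝ) → ℝ} (hΘb0 : ∀ q, Θb q 0 = 1 - ∑ i : Fin (n + 1), q (Fin.castSucc i))
    (hΘbs : ∀ q (i : Fin (n + 1)), Θb q i.succ = q (Fin.castSucc i))
    (hb : ∀ q, b q = Finset.univ.inf' Finset.univ_nonempty (fun k => (Θb q k)⁻¹))
    {B : Set (Fin (n + 2) → ℝ)} (hB : IsSemialgebraic ℚ B) : IsSemialgebraicFunOn ℚ B b := by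
  have h1 : IsSemialgebraicFunOn ℚ B (fun _ : Fin (n + 2) → ℝ => (1:ℝ)) :=
    isSemialgebraicFunOn_const_of_isAlgebraic hB isAlgebraic_one
  have hΘ : ∀ k, IsSemialgebraicFunOn ℚ B (fun q => Θb q k) := by
    refine Fin.cases ?_ (fun i => ?_)
    · exact (h1.fun_sub (IsSemialgebraicFunOn.fun_finsetSum Finset.univ hB
        fun i _ => isSemialgebraicFunOn_apply hB (Fin.castSucc i))).congr fun q _ => (hΘb0 q).symm
    · exact (isSemialgebraicFunOn_apply hB (Fin.castSucc i)).congr fun q _ => (hΘbs q i).symm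
  exact (isSemialgebraicFunOn_inf' hB Finset.univ_nonempty fun k _ => (hΘ k).fun_inv).congr
    fun q _ => (hb q).symm

/-- Values of the coordinate swap `e = (y v)` of `Fin (n + 3)`: it fixes the `θ`-slots and exchanges
the `y`-slot with the last one. [folklore] -/
theorem swap_vals {e : Equiv.Perm (Fin (n + 3))}
    (he : e = Equiv.swap (Fin.castSucc (Fin.last (n + 1))) (Fin.last (n + 2))) :
    (∀ i : Fin (n + 1), e (Fin.castSucc (Fin.castSucc i)) = Fin.castSucc (Fin.castSucc i)) ∧
    e (Fin.castSucc (Fin.last (n + 1))) = Fin.last (n + 2) ∧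
    e (Fin.last (n + 2)) = Fin.castSucc (Fin.last (n + 1)) := by
  subst he
  refine ⟨fun i => Equiv.swap_apply_of_ne_of_ne ?_ ?_, Equiv.swap_apply_left _ _,
    Equiv.swap_apply_right _ _⟩
  · exact fun h => (Fin.castSucc_lt_last i).ne (Fin.castSucc_injective _ h)
  · exact (Fin.castSucc_lt_last _).ne

/-- Membership in the closed band of the `y`-move (`y` last), spelled out in coordinates.
[folklore] -/
theorem mem_band_iff {Θb : (Fin (n + 2) → ℝ) → Fin (n + 2) → ℝ} {b : (Fin (n + 2) → ℝ) → ℝ}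
    (hΘb0 : ∀ q, Θb q 0 = 1 - ∑ i : Fin (n + 1), q (Fin.castSucc i))
    (hΘbs : ∀ q (i : Fin (n + 1)), Θb q i.succ = q (Fin.castSucc i))
    (hb : ∀ q, b q = Finset.univ.inf' Finset.univ_nonempty (fun k => (Θb q k)⁻¹))
    (z : Fin (n + 3) → ℝ) :
    z ∈ KZlog.band {q : Fin (n + 2) → ℝ | (∀ i : Fin (n + 1), 0 < q (Fin.castSucc i)) ∧
      ∑ i : Fin (n + 1), q (Fin.castSucc i) < 1 ∧ 0 < q (Fin.last (n + 1)) ∧ q (Fin.last (n + 1)) < 1}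
      (fun _ => 0) b ↔
    ((∀ i : Fin (n + 1), 0 < z (Fin.castSucc (Fin.castSucc i))) ∧
      ∑ i : Fin (n + 1), z (Fin.castSucc (Fin.castSucc i)) < 1 ∧
      0 < z (Fin.castSucc (Fin.last (n + 1))) ∧ z (Fin.castSucc (Fin.last (n + 1))) < 1 ∧
      0 ≤ z (Fin.last (n + 2)) ∧
      z (Fin.last (n + 2)) * (1 - ∑ i : Fin (n + 1), z (Fin.castSucc (Fin.castSucc i))) ≤ 1 ∧
      ∀ i : Fin (n + 1), z (Fin.last (n + 2)) * z (Fin.castSucc (Fin.castSucc i)) ≤ 1) := by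
  constructor
  · rintro ⟨⟨h1, h2, h3, h4⟩, h5, h6⟩
    obtain ⟨h7, h8⟩ := ((b_props hΘb0 hΘbs hb h1 h2).2.2.1 _).1 h6
    exact ⟨h1, h2, h3, h4, h5, h7, h8⟩
  · rintro ⟨h1, h2, h3, h4, h5, h7, h8⟩
    exact ⟨⟨h1, h2, h3, h4⟩, h5, ((b_props hΘb0 hΘbs hb h1 h2).2.2.1 _).2 ⟨h7, h8⟩⟩

/-- Membership in the open band of the `y`-move (`y` last) in coordinates: it is the swapped open
chart domain. [folklore] -/
theorem mem_openBand_iff {Θb : (Fin (n + 2) → ℝ) → Fin (n + 2) → ℝ} {b : (Fin (n + 2) → ℝ) → ℝ}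
    (hΘb0 : ∀ q, Θb q 0 = 1 - ∑ i : Fin (n + 1), q (Fin.castSucc i))
    (hΘbs : ∀ q (i : Fin (n + 1)), Θb q i.succ = q (Fin.castSucc i))
    (hb : ∀ q, b q = Finset.univ.inf' Finset.univ_nonempty (fun k => (Θb q k)⁻¹))
    (z : Fin (n + 3) → ℝ) :
    z ∈ {z : Fin (n + 3) → ℝ | Fin.init z ∈ {q : Fin (n + 2) → ℝ | (∀ i : Fin (n + 1), 0 < q (Fin.castSucc i)) ∧
      ∑ i : Fin (n + 1), q (Fin.castSucc i) < 1 ∧ 0 < q (Fin.last (n + 1)) ∧ q (Fin.last (n + 1)) < 1} ∧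
      (fun _ : Fin (n + 2) → ℝ => (0:ℝ)) (Fin.init z) < z (Fin.last (n + 2)) ∧
      z (Fin.last (n + 2)) < b (Fin.init z)} ↔
    (((∀ i : Fin (n + 1), 0 < z (Fin.castSucc (Fin.castSucc i))) ∧
      ∑ i : Fin (n + 1), z (Fin.castSucc (Fin.castSucc i)) < 1 ∧ 0 < z (Fin.last (n + 2)) ∧
      z (Fin.last (n + 2)) * (1 - ∑ i : Fin (n + 1), z (Fin.castSucc (Fin.castSucc i))) < 1 ∧
      ∀ i : Fin (n + 1), z (Fin.last (n + 2)) * z (Fin.castSucc (Fin.castSucc i)) < 1) ∧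
      0 < z (Fin.castSucc (Fin.last (n + 1))) ∧ z (Fin.castSucc (Fin.last (n + 1))) < 1) := by
  constructor
  · rintro ⟨⟨h1, h2, h3, h4⟩, h5, h6⟩
    obtain ⟨h7, h8⟩ := ((b_props hΘb0 hΘbs hb h1 h2).2.2.2.1 _).1 h6
    exact ⟨⟨h1, h2, h5, h7, h8⟩, h3, h4⟩
  · rintro ⟨⟨h1, h2, h5, h7, h8⟩, h3, h4⟩
    exact ⟨⟨h1, h2, h3, h4⟩, h5, ((b_props hΘb0 hΘbs hb h1 h2).2.2.2.1 _).2 ⟨h7, h8⟩⟩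

/-- The closed band of the `y`-move lies in the box `[0, n + 2]^(n+3)`, so it has finite volume.
[folklore] -/
theorem volume_band_lt_top {Θb : (Fin (n + 2) → ℝ) → Fin (n + 2) → ℝ} {b : (Fin (n + 2) → ℝ) → ℝ}
    (hΘb0 : ∀ q, Θb q 0 = 1 - ∑ i : Fin (n + 1), q (Fin.castSucc i))
    (hΘbs : ∀ q (i : Fin (n + 1)), Θb q i.succ = q (Fin.castSucc i))
    (hb : ∀ q, b q = Finset.univ.inf' Finset.univ_nonempty (fun k => (Θb q k)⁻¹)) :
    volume (KZlog.band {q : Fin (n + 2) → ℝ | (∀ i : Fin (n + 1), 0 < q (Fin.castSucc i)) ∧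
      ∑ i : Fin (n + 1), q (Fin.castSucc i) < 1 ∧ 0 < q (Fin.last (n + 1)) ∧ q (Fin.last (n + 1)) < 1}
      (fun _ => 0) b) < ⊤ := by
  refine lt_of_le_of_lt (measure_mono fun z hz => ?_)
    (measure_Icc_lt_top (a := (0 : Fin (n + 3) → ℝ)) (b := fun _ => (n:ℝ) + 2))
  obtain ⟨h1, h2, h3, h4, h5, h6, h7⟩ := (mem_band_iff hΘb0 hΘbs hb z).1 hz
  obtain ⟨-, -, hle, -, hbn⟩ := b_props (q := Fin.init z) hΘb0 hΘbs hb h1 h2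
  have hyb : z (Fin.last (n + 2)) ≤ (n:ℝ) + 2 := ((hle _).2 ⟨h6, h7⟩).trans hbn
  have hn : (0:ℝ) ≤ n := n.cast_nonneg
  have hθ : ∀ i : Fin (n + 1), z (Fin.castSucc (Fin.castSucc i)) ≤ 1 := fun i =>
    (Finset.single_le_sum (f := fun j => z (Fin.castSucc (Fin.castSucc j))) (fun j _ => (h1 j).le)
      (Finset.mem_univ i)).trans h2.le
  refine ⟨fun k => Fin.lastCases h5 (fun j => Fin.lastCases h3.le (fun i => (h1 i).le) j) k,
    fun k => Fin.lastCases hyb (fun j => Fin.lastCases ?_ (fun i => ?_) j) k⟩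
  · show z (Fin.castSucc (Fin.last (n + 1))) ≤ (n:ℝ) + 2
    linarith
  · show z (Fin.castSucc (Fin.castSucc i)) ≤ (n:ℝ) + 2
    linarith [hθ i]

end CornerYGeo

/-- **Geometry of the exceptional-face Newton–Leibniz move, general `p = n + 2`** (registered stub
`cornerYGeoGen`): for an abstract primitive `c` — `ℚ`-semialgebraic on the closed `y`-band `Wc`,
continuous on the closed `y`-fibres `[0, b]` (`b = min_k 1/Θ_k`), vanishing at `y = b` and equal to
the Beta × Dirichlet face density at `y = 0` — with a bounded `ℚ`-semialgebraic `y`-derivative `d` on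
the open chart domain `Wo`, and every representative `R` of the face, there is `N = [Wo, d]` with
`[N] + [R] ∈ KZ.relations`: put `y` last (swap `(y v)`), rule (3) on the band over
`B = {θ_i > 0, Σθ_i < 1, 0 < v < 1}` gives `[band, d] ∼ [B, c(·, b) − c(·, 0)] = [B, −face] = −[R]`,
then open the fibres and swap back (rule (2)). [cite: KontsevichZagier2001, §1.2 rule (3)] -/
theorem cornerYGeoGen : ∀ (n : ℕ) (x s : ℚ) (c d : (Fin (n + 3) → ℝ) → ℝ) (C : ℝ) (Wc Wo : Set (Fin (n + 3) → ℝ)),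
    Wc = {w : Fin (n + 3) → ℝ | (∀ i : Fin (n + 1), 0 < w (Fin.castSucc (Fin.castSucc i))) ∧ ∑ i : Fin (n + 1), w (Fin.castSucc (Fin.castSucc i)) < 1 ∧ 0 < w (Fin.last (n + 2)) ∧ w (Fin.last (n + 2)) < 1 ∧
      0 ≤ w (Fin.castSucc (Fin.last (n + 1))) ∧ w (Fin.castSucc (Fin.last (n + 1))) * (1 - ∑ i : Fin (n + 1), w (Fin.castSucc (Fin.castSucc i))) ≤ 1 ∧ ∀ i : Fin (n + 1), w (Fin.castSucc (Fin.last (n + 1))) * w (Fin.castSucc (Fin.castSucc i)) ≤ 1} →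
    Wo = {w : Fin (n + 3) → ℝ | (Fin.init w : Fin (n + 2) → ℝ) ∈ {u : Fin (n + 2) → ℝ | (∀ i : Fin (n + 1), 0 < u (Fin.castSucc i)) ∧ ∑ i : Fin (n + 1), u (Fin.castSucc i) < 1 ∧ 0 < u (Fin.last (n + 1)) ∧ u (Fin.last (n + 1)) * (1 - ∑ i : Fin (n + 1), u (Fin.castSucc i)) < 1 ∧ ∀ i : Fin (n + 1), u (Fin.last (n + 1)) * u (Fin.castSucc i) < 1} ∧ 0 < w (Fin.last (n + 2)) ∧ w (Fin.last (n + 2)) < 1} →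
    IsSemialgebraicFunOn ℚ Wc c →
    (∀ w ∈ Wc, ContinuousOn (fun a => c (Function.update w (Fin.castSucc (Fin.last (n + 1)) : Fin (n + 3)) a)) {a | Function.update w (Fin.castSucc (Fin.last (n + 1)) : Fin (n + 3)) a ∈ Wc}) →
    (∀ w ∈ Wc, (w (Fin.castSucc (Fin.last (n + 1))) * (1 - ∑ i : Fin (n + 1), w (Fin.castSucc (Fin.castSucc i))) = 1 ∨ ∃ i : Fin (n + 1), w (Fin.castSucc (Fin.last (n + 1))) * w (Fin.castSucc (Fin.castSucc i)) = 1) → c w = 0) →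
    (∀ w ∈ Wc, w (Fin.castSucc (Fin.last (n + 1))) = 0 →
      c w = (((n:ℝ) + 2) * (w (Fin.last (n + 2))) ^ (((n:ℝ) + 2) * (x:ℝ) - 1) * (1 - w (Fin.last (n + 2))) ^ (((n:ℝ) + 2) * (s:ℝ) - 1)) *
        (((n:ℝ) + 2) ^ (((n:ℝ) + 2) * (s:ℝ) - 1) * ((1 - ∑ i : Fin (n + 1), w (Fin.castSucc (Fin.castSucc i))) * ∏ i : Fin (n + 1), w (Fin.castSucc (Fin.castSucc i))) ^ ((s:ℝ) - 1))) →
    IsSemialgebraicFunOn ℚ Wo d → (∀ w ∈ Wo, |d w| ≤ C) →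
    (∀ w ∈ Wo, HasDerivAt (fun a => c (Function.update w (Fin.castSucc (Fin.last (n + 1)) : Fin (n + 3)) a)) (d w) (w (Fin.castSucc (Fin.last (n + 1)) : Fin (n + 3)))) →
    ∀ (R : KZ.IntegralRep (n + 2)), R.domain = {q : Fin (n + 2) → ℝ | (∀ i : Fin (n + 1), 0 < q (Fin.castSucc i)) ∧ ∑ i : Fin (n + 1), q (Fin.castSucc i) < 1 ∧ 0 < q (Fin.last (n + 1)) ∧ q (Fin.last (n + 1)) < 1} →
    Set.EqOn R.integrand (fun q => (((n:ℝ) + 2) * (q (Fin.last (n + 1))) ^ (((n:ℝ) + 2) * (x:ℝ) - 1) * (1 - q (Fin.last (n + 1))) ^ (((n:ℝ) + 2) * (s:ℝ) - 1)) *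
      (((n:ℝ) + 2) ^ (((n:ℝ) + 2) * (s:ℝ) - 1) * ((1 - ∑ i : Fin (n + 1), q (Fin.castSucc i)) * ∏ i : Fin (n + 1), q (Fin.castSucc i)) ^ ((s:ℝ) - 1))) R.domain →
    ∃ N : KZ.IntegralRep (n + 3), N.domain = Wo ∧ Set.EqOn N.integrand d N.domain ∧ KZ.of N + KZ.of R ∈ KZ.relations := by
  intro n x s c d C Wc Wo hWc hWo hcsa hccont hcvan hcface hdsa hdC hdder R hRd hRi
  -- the weights `Θ_k`, the fibre bound `b`, the base `B`, the closed band `Bd`, the swap `e`, `σ`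
  obtain ⟨Θb, hΘb0, hΘbs⟩ : ∃ Θb : (Fin (n + 2) → ℝ) → Fin (n + 2) → ℝ,
      (∀ q, Θb q 0 = 1 - ∑ i : Fin (n + 1), q (Fin.castSucc i)) ∧
      ∀ q (i : Fin (n + 1)), Θb q i.succ = q (Fin.castSucc i) :=
    ⟨fun q => Fin.cases (1 - ∑ i : Fin (n + 1), q (Fin.castSucc i)) (fun i => q (Fin.castSucc i)),
      fun _ => rfl, fun _ _ => rfl⟩
  obtain ⟨b, hb⟩ : ∃ b : (Fin (n + 2) → ℝ) → ℝ,
      ∀ q, b q = Finset.univ.inf' Finset.univ_nonempty (fun k => (Θb q k)⁻¹) := ⟨_, fun _ => rfl⟩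
  set B : Set (Fin (n + 2) → ℝ) := {q : Fin (n + 2) → ℝ | (∀ i : Fin (n + 1), 0 < q (Fin.castSucc i)) ∧
    ∑ i : Fin (n + 1), q (Fin.castSucc i) < 1 ∧ 0 < q (Fin.last (n + 1)) ∧ q (Fin.last (n + 1)) < 1}
  have hbq : ∀ {q}, q ∈ B → 0 < b q ∧ (b q * (1 - ∑ i : Fin (n + 1), q (Fin.castSucc i)) = 1 ∨
      ∃ i : Fin (n + 1), b q * q (Fin.castSucc i) = 1) := fun hq =>
    ⟨(CornerYGeo.b_props hΘb0 hΘbs hb hq.1 hq.2.1).1, (CornerYGeo.b_props hΘb0 hΘbs hb hq.1 hq.2.1).2.1⟩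
  have hBsa : IsSemialgebraic ℚ B := hRd ▸ R.isSemialgebraic_domain
  have hBmeas : MeasurableSet B := hBsa.measurableSet_holds
  have hasa : IsSemialgebraicFunOn ℚ B (fun _ : Fin (n + 2) → ℝ => (0:ℝ)) := by
    simpa using isSemialgebraicFunOn_ratCast hBsa 0
  have hbsa : IsSemialgebraicFunOn ℚ B b := CornerYGeo.isSemialgebraicFunOn_b hΘb0 hΘbs hb hBsa
  set Bd : Set (Fin (n + 3) → ℝ) := KZlog.band B (fun _ => (0:ℝ)) b with hBd
  have hBdsa : IsSemialgebraic ℚ Bd := KZlog.isSemialgebraic_band hasa hbsa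
  have hBdmeas : MeasurableSet Bd := hBdsa.measurableSet_holds
  set e : Fin (n + 3) ≃ Fin (n + 3) :=
    Equiv.swap (Fin.castSucc (Fin.last (n + 1)) : Fin (n + 3)) (Fin.last (n + 2)) with he
  obtain ⟨hecc, hey, hel⟩ := CornerYGeo.swap_vals he
  set σ : (Fin (n + 3) → ℝ) → (Fin (n + 3) → ℝ) := fun w i => w (e i) with hσ
  have hσσ : ∀ w, σ (σ w) = w := fun w => by ext i; simp [σ, e, Equiv.swap_apply_self]
  -- membership: `Wc` is the swapped closed band, `Wo` the swapped open band
  have hmemWc : ∀ w, w ∈ Wc ↔ σ w ∈ Bd := fun w => by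
    rw [hWc, hBd, CornerYGeo.mem_band_iff hΘb0 hΘbs hb (σ w)]
    simp only [mem_setOf_eq, hσ, hecc, hey, hel]
  have hmemWo : ∀ w, w ∈ Wo ↔ σ w ∈ {z : Fin (n + 3) → ℝ | Fin.init z ∈ B ∧
      (fun _ : Fin (n + 2) → ℝ => (0:ℝ)) (Fin.init z) < z (Fin.last (n + 2)) ∧
      z (Fin.last (n + 2)) < b (Fin.init z)} := fun w => by
    rw [hWo, CornerYGeo.mem_openBand_iff hΘb0 hΘbs hb (σ w)]
    simp only [mem_setOf_eq, hσ, hecc, hey, hel]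
    exact Iff.rfl
  have hWoWc : Wo ⊆ Wc := fun w hw => by
    rw [hWo] at hw; rw [hWc]; obtain ⟨⟨hpos, hsum, hy, h0, hk⟩, hv0, hv1⟩ := hw
    exact ⟨hpos, hsum, hv0, hv1, hy.le, h0.le, fun j => (hk j).le⟩
  -- the swapped open chart domain `W'`, the primitive `F` and the band integrand `f`
  have hWosa : IsSemialgebraic ℚ Wo := IsSemialgebraicFunOn.isSemialgebraic_holds hdsa
  set W' : Set (Fin (n + 3) → ℝ) := {z | σ z ∈ Wo} with hW'
  have hW'sa : IsSemialgebraic ℚ W' := hWosa.preimage_comp e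
  have hW'sub : W' ⊆ Bd := fun z hz => by
    have h := (hmemWc _).1 (hWoWc hz); rwa [hσσ] at h
  set F : (Fin (n + 3) → ℝ) → ℝ := fun z => c (σ z) with hF
  set f : (Fin (n + 3) → ℝ) → ℝ := W'.indicator fun z => d (σ z) with hf
  have hσmap : ∀ {T : Set (Fin (n + 3) → ℝ)}, IsSemialgebraic ℚ T → IsSemialgebraicMapOn ℚ T σ :=
    fun hT => IsSemialgebraicMapOn.of_forall hT fun j => isSemialgebraicFunOn_apply hT (e j)
  have hFsa : IsSemialgebraicFunOn ℚ Bd F :=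
    IsSemialgebraicFunOn.comp_isSemialgebraicMapOn_holds hcsa (hσmap hBdsa) fun z hz =>
      (hmemWc _).2 (show σ (σ z) ∈ Bd by rw [hσσ]; exact hz)
  have hfsa : IsSemialgebraicFunOn ℚ Bd f := by
    rw [← union_sdiff_cancel hW'sub]
    refine IsSemialgebraicFunOn.union (IsSemialgebraicFunOn.comp_isSemialgebraicMapOn_holds hdsa
      (hσmap hW'sa) fun z hz => hz) ((isSemialgebraicFunOn_ratCast (hBdsa.diff hW'sa) 0).congr
      fun _ _ => by push_cast; rfl) (fun z hz => indicator_of_mem hz _)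
      fun z hz => indicator_of_notMem hz.2 _
  have hfib : ∀ (q : Fin (n + 2) → ℝ) (a : ℝ),
      (∀ i : Fin (n + 1), σ (Fin.snoc q a) (Fin.castSucc (Fin.castSucc i)) = q (Fin.castSucc i)) ∧
      σ (Fin.snoc q a) (Fin.castSucc (Fin.last (n + 1))) = a ∧
      σ (Fin.snoc q a) (Fin.last (n + 2)) = q (Fin.last (n + 1)) := fun q a => by
    refine ⟨fun i => ?_, ?_, ?_⟩ <;>
      simp only [hσ, hecc, hey, hel, Fin.snoc_last] <;> exact Fin.snoc_castSucc (α := fun _ => ℝ) _ _ _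
  have hpath : ∀ (q : Fin (n + 2) → ℝ) (a t : ℝ),
      σ (Fin.snoc q a) = Function.update (σ (Fin.snoc q t)) (Fin.castSucc (Fin.last (n + 1))) a := by
    intro q a t; ext i
    refine Fin.lastCases ?_ (fun j => Fin.lastCases ?_ (fun i => ?_) j) i
    · rw [Function.update_of_ne (Fin.castSucc_lt_last _).ne', (hfib q a).2.2, (hfib q t).2.2]
    · rw [Function.update_self, (hfib q a).2.1]
    · rw [Function.update_of_ne fun h => (Fin.castSucc_lt_last i).ne (Fin.castSucc_injective _ h),
        (hfib q a).1, (hfib q t).1]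
  have hsnoc : ∀ q ∈ B, ∀ a ∈ Icc (0:ℝ) (b q), σ (Fin.snoc q a) ∈ Wc := fun q hq a ha =>
    (hmemWc _).2 (by rw [hσσ]; exact KZlog.snoc_mem_band.2 ⟨hq, ha⟩)
  have hfun : ∀ (q : Fin (n + 2) → ℝ) (t : ℝ), (fun a : ℝ => F (Fin.snoc q a)) = fun a =>
      c (Function.update (σ (Fin.snoc q t)) (Fin.castSucc (Fin.last (n + 1))) a) := fun q t =>
    funext fun a => by show c (σ (Fin.snoc q a)) = _; rw [hpath q a t]
  have hcont : ∀ q ∈ B, ContinuousOn (fun t : ℝ => F (Fin.snoc q t))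
      (Icc ((fun _ : Fin (n + 2) → ℝ => (0:ℝ)) q) (b q)) := by
    intro q hq
    rw [hfun q 0]
    refine (hccont _ (hsnoc q hq 0 ⟨le_rfl, (hbq hq).1.le⟩)).mono fun t ht => ?_
    show Function.update (σ (Fin.snoc q 0)) _ t ∈ Wc
    rw [← hpath q t 0]
    exact hsnoc q hq t ht
  have hder' : ∀ q ∈ B, ∀ t ∈ Ioo ((fun _ : Fin (n + 2) → ℝ => (0:ℝ)) q) (b q),
      HasDerivAt (fun t : ℝ => F (Fin.snoc q t)) (f (Fin.snoc q t)) t := by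
    intro q hq t ht
    have hw : σ (Fin.snoc q t) ∈ Wo := by
      rw [hmemWo, hσσ]
      simp only [mem_setOf_eq, Fin.init_snoc, Fin.snoc_last]
      exact ⟨hq, ht.1, ht.2⟩
    rw [show f (Fin.snoc q t) = d (σ (Fin.snoc q t)) from indicator_of_mem (show _ ∈ W' from hw) _,
      hfun q t]
    have h := hdder _ hw
    rwa [(hfib q t).2.1] at h
  have hint : IntegrableOn f Bd := by
    refine ⟨aestronglyMeasurable_of_isSemialgebraicFunOn hfsa hBdmeas,
      HasFiniteIntegral.restrict_of_bounded (C := |C|) (CornerYGeo.volume_band_lt_top hΘb0 hΘbs hb)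
        ((ae_restrict_mem hBdmeas).mono fun z _ => ?_)⟩
    rw [Real.norm_eq_abs]
    by_cases hz : z ∈ W'
    · rw [hf, indicator_of_mem hz]; exact (hdC _ hz).trans (le_abs_self C)
    · rw [hf, indicator_of_notMem hz, abs_zero]; exact abs_nonneg C
  -- the boundary values: `0` at `y = b`, the face density at `y = 0`
  have hbdry : ∀ q ∈ B, F (Fin.snoc q (b q)) - F (Fin.snoc q ((fun _ : Fin (n + 2) → ℝ => (0:ℝ)) q)) =
      -R.integrand q := by
    intro q hq
    obtain ⟨hb0, hor⟩ := hbq hq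
    have htop : F (Fin.snoc q (b q)) = 0 := by
      refine hcvan _ (hsnoc q hq _ ⟨hb0.le, le_rfl⟩) ?_
      simp only [(hfib q (b q)).1, (hfib q (b q)).2.1]
      exact hor
    have hzero : F (Fin.snoc q 0) = R.integrand q := by
      rw [hRi (show q ∈ R.domain by rw [hRd]; exact hq)]
      show c (σ (Fin.snoc q 0)) = _
      rw [hcface _ (hsnoc q hq 0 ⟨le_rfl, hb0.le⟩) (hfib q 0).2.1]
      simp only [(hfib q 0).1, (hfib q 0).2.2]
    show F (Fin.snoc q (b q)) - F (Fin.snoc q 0) = -R.integrand q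
    rw [htop, hzero]; ring
  have hRsa : IsSemialgebraicFunOn ℚ B R.integrand := hRd ▸ R.isSemialgebraicFunOn_integrand
  have hRint : IntegrableOn R.integrand B := hRd ▸ R.integrableOn
  have hds : IsSemialgebraicFunOn ℚ B
      (fun q => F (Fin.snoc q (b q)) - F (Fin.snoc q ((fun _ : Fin (n + 2) → ℝ => (0:ℝ)) q))) :=
    hRsa.neg.congr fun q hq => by rw [Pi.neg_apply, hbdry q hq]
  have hdi : IntegrableOn
      (fun q => F (Fin.snoc q (b q)) - F (Fin.snoc q ((fun _ : Fin (n + 2) → ℝ => (0:ℝ)) q))) B :=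
    hRint.neg.congr_fun (fun q hq => by rw [Pi.neg_apply, hbdry q hq]) hBmeas
  -- rule (3), opening the fibres, swapping back
  obtain ⟨rb, rd, hrbd, hrbi, hrdd, hrdi, hrel⟩ :=
    KZ.exists_band_newtonLeibniz hBsa (fun _ => (0:ℝ)) b hasa hbsa (fun q hq => (hbq hq).1.le)
      F f hFsa hfsa hcont hder' hint hds hdi
  obtain ⟨r', hr'd, hr'i, hr'rel⟩ := KZ.of_sub_of_restrict_openBand_mem_relations hasa hbsa rb hrbd
  have hNd : (r'.reindex e).domain = Wo := by
    ext w
    rw [IntegralRep.reindex_domain, mem_setOf_eq, hr'd, hmemWo]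
  refine ⟨r'.reindex e, hNd, fun w hw => ?_, ?_⟩
  · rw [hNd] at hw
    rw [IntegralRep.reindex_integrand, hr'i, hrbi]
    have hmem : σ w ∈ W' := by show σ (σ w) ∈ Wo; rw [hσσ]; exact hw
    show f (σ w) = d w
    rw [hf, indicator_of_mem hmem, hσσ]
  · -- `[rd] + [R] ∼ 0` (the boundary integrand is `−face`)
    have hsa : IsSemialgebraicFunOn ℚ B (fun q => rd.integrand q + R.integrand q) := by
      have h := rd.isSemialgebraicFunOn_integrand; rw [hrdd] at h; exact h.fun_add hRsa
    have hin : IntegrableOn (fun q => rd.integrand q + R.integrand q) B := by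
      have h := rd.integrableOn; rw [hrdd] at h; exact h.add hRint
    let r0 : KZ.IntegralRep (n + 2) := ⟨B, fun q => rd.integrand q + R.integrand q, hBsa, hsa, hin⟩
    have h0 : KZ.of r0 ∈ KZ.relations := KZ.of_mem_relations_of_eqOn_zero r0 fun q hq => by
      show rd.integrand q + R.integrand q = 0
      rw [hrdi]
      show F (Fin.snoc q (b q)) - F (Fin.snoc q ((fun _ : Fin (n + 2) → ℝ => (0:ℝ)) q)) +
        R.integrand q = 0
      rw [hbdry q hq]; ring
    have h1 : KZ.of r0 - KZ.of rd - KZ.of R ∈ KZ.relations :=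
      KZ.integrandAddRel_subset_relations ⟨n + 2, r0, rd, R, hrdd, hRd, fun q _ => rfl, rfl⟩
    have hrdR : KZ.of rd + KZ.of R ∈ KZ.relations := by
      rw [show KZ.of rd + KZ.of R = KZ.of r0 - (KZ.of r0 - KZ.of rd - KZ.of R) by abel]
      exact KZ.relations.sub_mem h0 h1
    rw [show KZ.of (r'.reindex e) + KZ.of R = -(KZ.of r' - KZ.of (r'.reindex e)) -
      (KZ.of rb - KZ.of r') + (KZ.of rb - KZ.of rd) + (KZ.of rd + KZ.of R) by abel]
    exact KZ.relations.add_mem (KZ.relations.add_mem (KZ.relations.sub_mem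
      (KZ.relations.neg_mem (KZ.of_sub_of_reindex_mem_relations r' e)) hr'rel) hrel) hrdR

end Summit.KontsevichZagierPeriods.TerasomaMultiplication.MultiplicationAccessible

end
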